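import Summits.CriticalPhenomena.PercolationContinuityZ3.Theorems.PercNearOneGluingNoHeavyLowerTailThreePointHalvingTwoHubPiece
import Summits.CriticalPhenomena.PercolationContinuityZ3.Theorems.PercNearOneGluingNoHeavyLowerTailThreePointPiecesTwoHubsCoords
import HarnessLib

/-!
# The halving lemma (v) on every weighted graph whose 3-terminal pieces have at most two inner vertices — in particular on
# EVERY weighted graph with at most five vertices (Sahi programme, prover prim-sahi-p2 gen 46)

Support file (`--supports stmt-CriticalPhenomena-4575`, helper).  No definitions, no named facts, no sorries; standard axioms.
Assembles: gen 45's parallel-closure theorem `HalvingParallel.halvingUD_of_pieces` ((v) for a parallel composition at `{a, s, c}` of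
pieces each satisfying (v) in its cylinder isolation coordinates), the single-hub piece (`ThreePointPieces.isoPiece_hub_eq` +
`HalvingParallel.star_halving`), and the TWO-HUB piece: its cylinder coordinates are affine in the interior weight
(`ThreePointPiecesTwoHub.real_isoPiece_twoHub`, `real_sepPiece_twoHub`) and the resulting 7-variable inequality is
`HalvingTwoHub.twoHubPair_halving` (pencil + Bernstein certificate of the cross term).
* `hubPiece_halving`, `twoHubPiece_halving` [this work] — the `hV` hypothesis of `halvingIso_of_pieces` for a piece with one resp.
  exactly two non-terminal vertices, ALL weights.
* `halvingUD_of_smallPieces` [this work] — **(v) `μ(U)·μ(D) ≤ 2·μ(U ∩ D)` (`U = {s↔a} ∪ {c↔a}`, `D = {s↮c}`) on every weighted graph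
  that is a parallel composition at `{a, s, c}` of pieces with at most two inner vertices each** (terminal–terminal pairs arbitrary);
  `seriesPiece_halving`, `halvingUD_of_smallOrSeriesPieces` add prim-l12-p1's SERIES pieces (one terminal separates the other two inside
  the piece: two-terminal blobs, terminal-cut-vertex pieces; `ThreePointPieces.real_series`) to the admissible pieces.
* `halvingUD_of_card_le_five` [this work] — **(v) on EVERY weighted graph with at most five vertices, all weights, any three distinct
  terminals** (`≤ 1` non-terminal: hub graph, gen 45; `2` non-terminals: one two-hub piece).  The census certified this numerically
  (W221: 59 049 tensor-Bernstein coefficients of the full `K₅`); here it is a theorem, and the first (v)-class containing a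
  3-terminal-prime piece that is not a hub.
Nothing here asserts (v) for general graphs (pieces with ≥ 3 inner vertices are open).
-/

namespace Summit.CriticalPhenomena.PercolationContinuityZ3.Theorems.HalvingTwoHub

open MeasureTheory Set
open Literature.Probability.Percolation Literature.Probability.LatticeModels
open Summit.CriticalPhenomena.PercolationContinuityZ3.Theorems.ThreePointPieces
open Summit.CriticalPhenomena.PercolationContinuityZ3.Theorems.ThreePointPiecesTwoHub
open Summit.CriticalPhenomena.PercolationContinuityZ3.Theorems.HalvingParallel

variable {V : Type*} [Fintype V] [DecidableEq V] {ι : Type*} [Fintype ι] [DecidableEq ι]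

omit [Fintype ι] in
/-- **A single-hub piece satisfies (v) in its cylinder isolation coordinates** (`star_halving` on the piece events
`isoPiece = isoH`). [this work] -/
theorem hubPiece_halving (w : Sym2 V → unitInterval) {a s c : V} (has : a ≠ s) (hac : a ≠ c) (hsc : s ≠ c) (part : V → ι)
    {i : ι} {h : V} (hh : h ∉ terms a s c) (hhi : part h = i) (hi : ∀ v, v ∉ terms a s c → part v = i → v = h) :
    (prodBernoulli w).real (isoPiece (piecePairs a s c part i) a s c ∩ isoPiece (piecePairs a s c part i) s a c) *
        (3 + (prodBernoulli w).real (isoPiece (piecePairs a s c part i) a s c)) ≤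
      (1 + (prodBernoulli w).real (isoPiece (piecePairs a s c part i) a s c)) *
        ((prodBernoulli w).real (isoPiece (piecePairs a s c part i) s a c) +
          (prodBernoulli w).real (isoPiece (piecePairs a s c part i) c a s)) := by
  have ha : a ∈ terms a s c := mem_terms.2 (Or.inl rfl)
  have hs : s ∈ terms a s c := mem_terms.2 (Or.inr (Or.inl rfl))
  have hc : c ∈ terms a s c := mem_terms.2 (Or.inr (Or.inr rfl))
  have eA := isoPiece_hub_eq part hh hhi hi ha hs hc has hac
  have eB := isoPiece_hub_eq part hh hhi hi hs ha hc (Ne.symm has) hsc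
  have eC := isoPiece_hub_eq part hh hhi hi hc ha hs (Ne.symm hac) (Ne.symm hsc)
  set x : ℝ := (w s(a, h) : ℝ)
  set y : ℝ := (w s(s, h) : ℝ)
  set z : ℝ := (w s(c, h) : ℝ)
  have rQ : (prodBernoulli w).real (isoPiece (piecePairs a s c part i) a s c ∩ isoPiece (piecePairs a s c part i) s a c) =
      1 - x * y - x * z - y * z + 2 * x * y * z := by
    rw [eA, eB, ThreePointHubEvents.real_sepH w has hac hsc]
  have rA : (prodBernoulli w).real (isoPiece (piecePairs a s c part i) a s c) = 1 - x * (y + z - y * z) := by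
    rw [eA, ThreePointHubEvents.real_isoH w has hac hsc]; ring
  have rB : (prodBernoulli w).real (isoPiece (piecePairs a s c part i) s a c) = 1 - y * (x + z - x * z) := by
    rw [eB, ThreePointHubEvents.real_isoH w (Ne.symm has) hsc hac]; ring
  have rC : (prodBernoulli w).real (isoPiece (piecePairs a s c part i) c a s) = 1 - z * (x + y - x * y) := by
    rw [eC, ThreePointHubEvents.real_isoH w (Ne.symm hac) (Ne.symm hsc) has]; ring
  rw [rQ, rA, rB, rC]
  exact star_halving (unitInterval.nonneg _) (unitInterval.nonneg _) (unitInterval.le_one _) (unitInterval.nonneg _)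
    (unitInterval.le_one _)

omit [Fintype ι] in
/-- **A two-hub piece satisfies (v) in its cylinder isolation coordinates, all seven weights** (`real_isoPiece_twoHub`,
`real_sepPiece_twoHub` + `twoHubPair_halving`). [this work] -/
theorem twoHubPiece_halving (w : Sym2 V → unitInterval) {a s c : V} (has : a ≠ s) (hac : a ≠ c) (hsc : s ≠ c) (part : V → ι)
    {i : ι} {h₁ h₂ : V} (h12 : h₁ ≠ h₂) (hh₁ : h₁ ∉ terms a s c) (hh₂ : h₂ ∉ terms a s c) (hi₁ : part h₁ = i) (hi₂ : part h₂ = i)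
    (hi : ∀ v, v ∉ terms a s c → part v = i → v = h₁ ∨ v = h₂) :
    (prodBernoulli w).real (isoPiece (piecePairs a s c part i) a s c ∩ isoPiece (piecePairs a s c part i) s a c) *
        (3 + (prodBernoulli w).real (isoPiece (piecePairs a s c part i) a s c)) ≤
      (1 + (prodBernoulli w).real (isoPiece (piecePairs a s c part i) a s c)) *
        ((prodBernoulli w).real (isoPiece (piecePairs a s c part i) s a c) +
          (prodBernoulli w).real (isoPiece (piecePairs a s c part i) c a s)) := by
  have ha : a ∈ terms a s c := mem_terms.2 (Or.inl rfl)
  have hs : s ∈ terms a s c := mem_terms.2 (Or.inr (Or.inl rfl))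
  have hc : c ∈ terms a s c := mem_terms.2 (Or.inr (Or.inr rfl))
  have hTa : ∀ v, v ∈ terms a s c → v = a ∨ v = s ∨ v = c := fun v hv => mem_terms.1 hv
  have hTs : ∀ v, v ∈ terms a s c → v = s ∨ v = a ∨ v = c := fun v hv => by
    rcases mem_terms.1 hv with e | e | e
    · exact Or.inr (Or.inl e)
    · exact Or.inl e
    · exact Or.inr (Or.inr e)
  have hTc : ∀ v, v ∈ terms a s c → v = c ∨ v = a ∨ v = s := fun v hv => by
    rcases mem_terms.1 hv with e | e | e
    · exact Or.inr (Or.inl e)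
    · exact Or.inr (Or.inr e)
    · exact Or.inl e
  have rA := real_isoPiece_twoHub w h12 hh₁ hh₂ hi₁ hi₂ hi hTa ha hs hc has hac hsc
  have rB := real_isoPiece_twoHub w h12 hh₁ hh₂ hi₁ hi₂ hi hTs hs ha hc (Ne.symm has) hsc hac
  have rC := real_isoPiece_twoHub w h12 hh₁ hh₂ hi₁ hi₂ hi hTc hc ha hs (Ne.symm hac) (Ne.symm hsc) has
  have rQ := real_sepPiece_twoHub w has hac hsc h12 hh₁ hh₂ hi₁ hi₂ hi
  set lam : ℝ := (w s(h₁, h₂) : ℝ)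
  set x1 : ℝ := (w s(a, h₁) : ℝ)
  set y1 : ℝ := (w s(s, h₁) : ℝ)
  set z1 : ℝ := (w s(c, h₁) : ℝ)
  set x2 : ℝ := (w s(a, h₂) : ℝ)
  set y2 : ℝ := (w s(s, h₂) : ℝ)
  set z2 : ℝ := (w s(c, h₂) : ℝ)
  have key := twoHubPair_halving (lam := lam) (x1 := x1) (y1 := y1) (z1 := z1) (x2 := x2) (y2 := y2) (z2 := z2)
    (unitInterval.nonneg _) (unitInterval.le_one _) (unitInterval.nonneg _) (unitInterval.le_one _) (unitInterval.nonneg _)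
    (unitInterval.le_one _) (unitInterval.nonneg _) (unitInterval.le_one _) (unitInterval.nonneg _) (unitInterval.le_one _)
    (unitInterval.nonneg _) (unitInterval.le_one _) (unitInterval.nonneg _) (unitInterval.le_one _)
  have eA : (prodBernoulli w).real (isoPiece (piecePairs a s c part i) a s c) =
      (1 - lam) * (hubA x1 y1 z1 * hubA x2 y2 z2) + lam * hubA (x1 + x2 - x1 * x2) (y1 + y2 - y1 * y2) (z1 + z2 - z1 * z2) := by
    rw [rA]; unfold hubA; ring
  have eB : (prodBernoulli w).real (isoPiece (piecePairs a s c part i) s a c) =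
      (1 - lam) * (hubB x1 y1 z1 * hubB x2 y2 z2) + lam * hubB (x1 + x2 - x1 * x2) (y1 + y2 - y1 * y2) (z1 + z2 - z1 * z2) := by
    rw [rB]; unfold hubB; ring
  have eC : (prodBernoulli w).real (isoPiece (piecePairs a s c part i) c a s) =
      (1 - lam) * (hubC x1 y1 z1 * hubC x2 y2 z2) + lam * hubC (x1 + x2 - x1 * x2) (y1 + y2 - y1 * y2) (z1 + z2 - z1 * z2) := by
    rw [rC]; unfold hubC; ring
  have eQ : (prodBernoulli w).real (isoPiece (piecePairs a s c part i) a s c ∩ isoPiece (piecePairs a s c part i) s a c) =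
      (1 - lam) * (hubQ x1 y1 z1 * hubQ x2 y2 z2) + lam * hubQ (x1 + x2 - x1 * x2) (y1 + y2 - y1 * y2) (z1 + z2 - z1 * z2) := by
    rw [rQ]; unfold hubQ; ring
  rw [eA, eB, eC, eQ]
  exact key

/-- The algebra of (v) for a series piece: from "middle isolation = separation" and "separation = product of the sides"
(`ThreePointPieces.real_series`), `Q(3 + A) ≤ (1 + A)(B + C)` in each of the three orientations. [this work] -/
theorem halving_of_series_eqs {Q A B C : ℝ} (hA1 : A ≤ 1) (hB : 0 ≤ B) (hB1 : B ≤ 1) (hC : 0 ≤ C) (hC1 : C ≤ 1)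
    (h : (A = Q ∧ Q = B * C) ∨ (B = Q ∧ Q = A * C) ∨ (C = Q ∧ Q = A * B)) :
    Q * (3 + A) ≤ (1 + A) * (B + C) := by
  rcases h with ⟨hAQ, hP⟩ | ⟨hBQ, hP⟩ | ⟨hCQ, hP⟩
  · subst hAQ; rw [hP]
    nlinarith [S_nonneg hB hB1 hC hC1, mul_nonneg hB hC]
  · subst hBQ; rw [hP]
    nlinarith [mul_nonneg hC (sub_nonneg.2 hA1)]
  · subst hCQ; rw [hP]
    nlinarith [mul_nonneg hB (sub_nonneg.2 hA1)]

omit [Fintype ι] in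
/-- **A series piece satisfies (v) in its cylinder isolation coordinates** (middle terminal `a`, `s` or `c`; `x`-side `X`):
a piece in which one terminal separates the other two — in particular every piece touching at most two terminals. [this work] -/
theorem seriesPiece_halving (w : Sym2 V → unitInterval) {a s c : V} (has : a ≠ s) (hac : a ≠ c) (hsc : s ≠ c) (part : V → ι)
    {i : ι} (X : Finset V)
    (hsep : (∀ u v : V, (u = s ∨ (u ∉ terms a s c ∧ part u = i ∧ u ∈ X)) → (v = c ∨ (v ∉ terms a s c ∧ part v = i ∧ v ∉ X)) →
        ((u ∉ terms a s c ∧ part u = i ∧ u ∈ X) ∨ (v ∉ terms a s c ∧ part v = i ∧ v ∉ X)) → (w s(u, v) : ℝ) = 0) ∨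
      (∀ u v : V, (u = a ∨ (u ∉ terms a s c ∧ part u = i ∧ u ∈ X)) → (v = c ∨ (v ∉ terms a s c ∧ part v = i ∧ v ∉ X)) →
        ((u ∉ terms a s c ∧ part u = i ∧ u ∈ X) ∨ (v ∉ terms a s c ∧ part v = i ∧ v ∉ X)) → (w s(u, v) : ℝ) = 0) ∨
      (∀ u v : V, (u = a ∨ (u ∉ terms a s c ∧ part u = i ∧ u ∈ X)) → (v = s ∨ (v ∉ terms a s c ∧ part v = i ∧ v ∉ X)) →
        ((u ∉ terms a s c ∧ part u = i ∧ u ∈ X) ∨ (v ∉ terms a s c ∧ part v = i ∧ v ∉ X)) → (w s(u, v) : ℝ) = 0)) :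
    (prodBernoulli w).real (isoPiece (piecePairs a s c part i) a s c ∩ isoPiece (piecePairs a s c part i) s a c) *
        (3 + (prodBernoulli w).real (isoPiece (piecePairs a s c part i) a s c)) ≤
      (1 + (prodBernoulli w).real (isoPiece (piecePairs a s c part i) a s c)) *
        ((prodBernoulli w).real (isoPiece (piecePairs a s c part i) s a c) +
          (prodBernoulli w).real (isoPiece (piecePairs a s c part i) c a s)) := by
  set F := piecePairs a s c part i with hF
  have ha : a ∈ terms a s c := mem_terms.2 (Or.inl rfl)
  have hs : s ∈ terms a s c := mem_terms.2 (Or.inr (Or.inl rfl))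
  have hc : c ∈ terms a s c := mem_terms.2 (Or.inr (Or.inr rfl))
  have eB : isoPiece F s c a = isoPiece F s a c := isoPiece_swap F s c a
  have eC : isoPiece F c s a = isoPiece F c a s := isoPiece_swap F c s a
  have eA : isoPiece F a c s = isoPiece F a s c := isoPiece_swap F a c s
  have eQ1 : isoPiece F s c a ∩ isoPiece F c s a = isoPiece F a s c ∩ isoPiece F s a c := by
    rw [eB, eC]; exact isoPiece_inter_eq F a s c
  have eQ2 : isoPiece F a c s ∩ isoPiece F c a s = isoPiece F a s c ∩ isoPiece F s a c := by
    rw [eA, ← eC, isoPiece_inter_eq F s a c, Set.inter_comm]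
  refine halving_of_series_eqs measureReal_le_one measureReal_nonneg measureReal_le_one measureReal_nonneg measureReal_le_one ?_
  rcases hsep with h | h | h
  · -- middle terminal `a`
    have hT : ∀ v, v ∈ terms a s c → v = s ∨ v = c ∨ v = a := fun v hv => by rcases mem_terms.1 hv with e | e | e <;> tauto
    obtain ⟨h1, h2⟩ := real_series w (part := part) (i := i) (X := X) hT hs hc ha hsc (Ne.symm has) (Ne.symm hac) h
    rw [eQ1] at h1 h2; rw [eB, eC] at h2
    exact Or.inl ⟨h1, h2⟩
  · -- middle terminal `s`
    have hT : ∀ v, v ∈ terms a s c → v = a ∨ v = c ∨ v = s := fun v hv => by rcases mem_terms.1 hv with e | e | e <;> tauto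
    obtain ⟨h1, h2⟩ := real_series w (part := part) (i := i) (X := X) hT ha hc hs hac has (Ne.symm hsc) h
    rw [eQ2] at h1 h2; rw [eA] at h2
    exact Or.inr (Or.inl ⟨h1, h2⟩)
  · -- middle terminal `c`
    have hT : ∀ v, v ∈ terms a s c → v = a ∨ v = s ∨ v = c := fun v hv => mem_terms.1 hv
    obtain ⟨h1, h2⟩ := real_series w (part := part) (i := i) (X := X) hT ha hs hc has hac hsc h
    exact Or.inr (Or.inr ⟨h1, h2⟩)

/-- **(v) on every parallel composition of pieces with at most two inner vertices, all weights.**  Let `part : V → ι` label the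
vertices so that two non-terminal vertices with different labels are never joined, and suppose every label class contains one or
two non-terminal vertices.  Then `μ(U)·μ(D) ≤ 2·μ(U ∩ D)` with `U = {s↔a} ∪ {c↔a}`, `D = {s↮c}`. [this work] -/
theorem halvingUD_of_smallPieces (w : Sym2 V → unitInterval) {a s c : V} (has : a ≠ s) (hac : a ≠ c) (hsc : s ≠ c)
    (part : V → ι) (hw : ∀ u v : V, u ∉ terms a s c → v ∉ terms a s c → part u ≠ part v → (w s(u, v) : ℝ) = 0)
    (hsmall : ∀ i, ∃ h₁ h₂, h₁ ∉ terms a s c ∧ h₂ ∉ terms a s c ∧ part h₁ = i ∧ part h₂ = i ∧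
      ∀ v, v ∉ terms a s c → part v = i → v = h₁ ∨ v = h₂) :
    (prodBernoulli w).real (openConn s a ∪ openConn c a) * (prodBernoulli w).real ((openConn s c)ᶜ) ≤
      2 * (prodBernoulli w).real ((openConn s a ∪ openConn c a) ∩ (openConn s c)ᶜ) := by
  refine halvingUD_of_pieces w has hac hsc part hw fun i => ?_
  obtain ⟨h₁, h₂, hh₁, hh₂, hi₁, hi₂, hi⟩ := hsmall i
  by_cases h12 : h₁ = h₂
  · subst h12
    exact hubPiece_halving w has hac hsc part hh₁ hi₁ fun v hv hvi => (hi v hv hvi).elim id id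
  · exact twoHubPiece_halving w has hac hsc part h12 hh₁ hh₂ hi₁ hi₂ hi

/-- **(v) on every parallel composition of pieces that have at most two inner vertices OR are series pieces** (one terminal
separates the other two inside the piece; e.g. two-terminal blobs between a pair of terminals, terminal-cut-vertex pieces), all
weights. [this work] -/
theorem halvingUD_of_smallOrSeriesPieces (w : Sym2 V → unitInterval) {a s c : V} (has : a ≠ s) (hac : a ≠ c) (hsc : s ≠ c)
    (part : V → ι) (hw : ∀ u v : V, u ∉ terms a s c → v ∉ terms a s c → part u ≠ part v → (w s(u, v) : ℝ) = 0)
    (hpc : ∀ i, (∃ h₁ h₂, h₁ ∉ terms a s c ∧ h₂ ∉ terms a s c ∧ part h₁ = i ∧ part h₂ = i ∧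
        ∀ v, v ∉ terms a s c → part v = i → v = h₁ ∨ v = h₂) ∨
      ∃ X : Finset V,
        (∀ u v : V, (u = s ∨ (u ∉ terms a s c ∧ part u = i ∧ u ∈ X)) → (v = c ∨ (v ∉ terms a s c ∧ part v = i ∧ v ∉ X)) →
            ((u ∉ terms a s c ∧ part u = i ∧ u ∈ X) ∨ (v ∉ terms a s c ∧ part v = i ∧ v ∉ X)) → (w s(u, v) : ℝ) = 0) ∨
          (∀ u v : V, (u = a ∨ (u ∉ terms a s c ∧ part u = i ∧ u ∈ X)) → (v = c ∨ (v ∉ terms a s c ∧ part v = i ∧ v ∉ X)) →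
            ((u ∉ terms a s c ∧ part u = i ∧ u ∈ X) ∨ (v ∉ terms a s c ∧ part v = i ∧ v ∉ X)) → (w s(u, v) : ℝ) = 0) ∨
          (∀ u v : V, (u = a ∨ (u ∉ terms a s c ∧ part u = i ∧ u ∈ X)) → (v = s ∨ (v ∉ terms a s c ∧ part v = i ∧ v ∉ X)) →
            ((u ∉ terms a s c ∧ part u = i ∧ u ∈ X) ∨ (v ∉ terms a s c ∧ part v = i ∧ v ∉ X)) → (w s(u, v) : ℝ) = 0)) :
    (prodBernoulli w).real (openConn s a ∪ openConn c a) * (prodBernoulli w).real ((openConn s c)ᶜ) ≤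
      2 * (prodBernoulli w).real ((openConn s a ∪ openConn c a) ∩ (openConn s c)ᶜ) := by
  refine halvingUD_of_pieces w has hac hsc part hw fun i => ?_
  rcases hpc i with ⟨h₁, h₂, hh₁, hh₂, hi₁, hi₂, hi⟩ | ⟨X, hX⟩
  · by_cases h12 : h₁ = h₂
    · subst h12
      exact hubPiece_halving w has hac hsc part hh₁ hi₁ fun v hv hvi => (hi v hv hvi).elim id id
    · exact twoHubPiece_halving w has hac hsc part h12 hh₁ hh₂ hi₁ hi₂ hi
  · exact seriesPiece_halving w has hac hsc part X hX

/-- **THE HALVING LEMMA (v) ON EVERY WEIGHTED GRAPH WITH AT MOST FIVE VERTICES.**  For every finite vertex type with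
`card V ≤ 5`, every weight function and any three distinct terminals `a, s, c`: `μ(U)·μ(D) ≤ 2·μ(U ∩ D)`
(`U = {s↔a} ∪ {c↔a}`, `D = {s↮c}`). [this work] -/
theorem halvingUD_of_card_le_five (hV : Fintype.card V ≤ 5) (w : Sym2 V → unitInterval) {a s c : V} (has : a ≠ s) (hac : a ≠ c)
    (hsc : s ≠ c) :
    (prodBernoulli w).real (openConn s a ∪ openConn c a) * (prodBernoulli w).real ((openConn s c)ᶜ) ≤
      2 * (prodBernoulli w).real ((openConn s a ∪ openConn c a) ∩ (openConn s c)ᶜ) := by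
  classical
  set N : Finset V := Finset.univ \ terms a s c with hN
  have hterms : (terms a s c).card = 3 := by
    unfold terms
    rw [Finset.card_insert_of_notMem (by simp [has, hac]), Finset.card_insert_of_notMem (by simp [hsc]), Finset.card_singleton]
  have hNc : N.card ≤ 2 := by
    have h1 := Finset.card_sdiff_add_card_eq_card (Finset.subset_univ (terms a s c))
    rw [Finset.card_univ, hterms] at h1
    rw [hN]; omega
  have memN : ∀ {v : V}, v ∈ N ↔ v ∉ terms a s c := fun {v} => by rw [hN, Finset.mem_sdiff]; simp
  by_cases h2 : N.card ≤ 1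
  · -- at most one non-terminal: a hub graph
    refine halvingUD_hubGraph w has hac hsc fun u v hua hus huc hva hvs hvc huv => ?_
    exfalso
    have hu : u ∈ N := memN.2 (by simp [mem_terms, hua, hus, huc])
    have hv : v ∈ N := memN.2 (by simp [mem_terms, hva, hvs, hvc])
    exact huv (Finset.card_le_one.1 h2 u hu v hv)
  · -- exactly two non-terminals: one two-hub piece
    have hN2 : N.card = 2 := by omega
    obtain ⟨h₁, h₂, h12, hNe⟩ := Finset.card_eq_two.1 hN2
    have hh₁ : h₁ ∉ terms a s c := memN.1 (by rw [hNe]; simp)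
    have hh₂ : h₂ ∉ terms a s c := memN.1 (by rw [hNe]; simp)
    refine halvingUD_of_smallPieces w has hac hsc (fun _ => (0 : Fin 1)) (fun u v _ _ h => (h rfl).elim) fun i => ?_
    refine ⟨h₁, h₂, hh₁, hh₂, Subsingleton.elim _ _, Subsingleton.elim _ _, fun v hv _ => ?_⟩
    have hvN : v ∈ N := memN.2 hv
    rw [hNe] at hvN
    simpa using hvN

end Summit.CriticalPhenomena.PercolationContinuityZ3.Theorems.HalvingTwoHub
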